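import Mathlib
import Summits.ResolutionOfSingularities.ResolutionOfSingularities.Theorems.RadicialJungCleanModelsCleanPointBlowupChart
import HarnessLib

/-!
# Route `RadicialJung`, crux `CleanModels` (stmt-ResolutionOfSingularities-15917), line `Sketch` rev 35, stub 6 `stub_cleanProp44` (X44c):
# CLEAN-PERMISSIBILITY OF NEAR LINES, VII — a clean side is NEVER TANGENT to a near line (abstract chart)

Seat decomp-res-hand-2 g18 (structural hand).  The local classification ✓ `cleanPermissibleAt_exceptionalCurve_or_obstruction`
(`…CleanProp44NearLineClassification.lean`) leaves three obstructions on a near line: corners, TANGENT sides, births.  Here the tangent one is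
removed for near lines, in the abstract chart data of the blowing up of a regular local ring `R` at its closed point
(`…CleanPointBlowupChart.lean`: regular system of parameters `t : Fin d → R` with `(t) = 𝔪`, chart `t_j`, `A ⊇ ψ(R)`, fractions `u_i` with
`ψ(t_i) = ψ(t_j) u_i`, `ε : κ[T_i]_{i ≠ j} ≅ A/(ψ t_j)`, a prime `𝔓` over `𝔪`, `L = A_𝔓`).  A NEAR LINE through the point is `N = (ψ t_j, u_{j₀})`
for an index `j₀ ≠ j` with `u_{j₀} ∈ 𝔓` ([CoP1] Lemma 4.3 (5): `(u, y')` with `y = t_{j₀}` the directrix variable of a `τ = 1` point;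
✓ `CP2008Prop44.stalkIdeal_vanishingIdeal_closure_eq_span_pair_of_adapted`); a CLEAN SIDE is `V(t')` for any `t' ∈ 𝔪_R` (a member of ANOTHER
regular system of parameters of `R`), whose transform reads `ψ(t') = ψ(t_j) · s` with `s = Σ_k ψ(m_k) u_k` for `t' = Σ_k m_k t_k`.  PROVED:

* `not_mem_map_sup_sq_of_derivation` — THE DERIVATION OBSTRUCTION RELATIVE TO AN IDEAL (Stacks 07PF style, `p`-free): `φ : O → E`, primes
  `Q ∩ O = q`, an ideal `K ⊆ q` with `D(φ K) ⊆ Q` for a derivation `D` of `E`, and `f ∈ O` with `D(φ f) ∉ Q`; then `f ∉ K O_q + 𝔪_{O_q}²`.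
* `exists_side_eq_mul` — `ψ(t') = ψ(t_j) · Σ_k ψ(m_k) u_k`.
* `side_mem_nearLine_of_mem_sup_sq` — **no tangency**: if `s = Σ_k ψ(m_k) u_k` lies in `N L + 𝔪_L²`, then `s ∈ N L` (the side CONTAINS the near
  line at the point).  Proof: for `k ≠ j, j₀` the derivation `∂/∂T_k` of the exceptional chart `κ[T]` kills the reductions `0`, `T_{j₀}` of the
  generators of `N` and sends the reduction `m̄_j + Σ_{i ≠ j} m̄_i T_i` of `s` to the constant `m̄_k`; so `m̄_k = 0` by the obstruction, i.e.
  `m_k ∈ 𝔪_R`, `ψ(m_k) ∈ (ψ t_j)`; then `s ≡ ψ(m_j) (mod N)` forces `m_j ∈ 𝔪_R` too.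
* `side_trichotomy_nearLine` — consequently a clean side through the point is TRANSVERSAL to the near line or CONTAINS it
  (given a third parameter `z'` with `(ψ t_j, u_{j₀}, z') = 𝔪_L`).

Honest framing: OURS, elementary; a TOOL for the (R1ᵐⁱⁿ)/(R3ᵐⁱⁿ′) provers (scheme-level packaging is the companion step).  Nothing here proves
X44c, any case of `CleanModels`, or resolution of singularities in characteristic `p`.  Setting only: [cite: StacksProject, Tag 07PF]
[cite: CossartPiltant2008, Lemma 4.3 (5)] [cite: Piltant2013, §2 Axiom 4].
-/

noncomputable section

set_option linter.dupNamespace false -- mandated namespace of this single-conjunct summit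

open IsLocalRing MvPolynomial
open Literature.AlgebraicGeometry.Resolution

namespace Summit.ResolutionOfSingularities.ResolutionOfSingularities.Theorems.RadicialJung.CleanModels

universe u

/-! ## §0 The derivation obstruction relative to an ideal -/

/-- **The derivation obstruction relative to an ideal** (Stacks 07PF style, characteristic-free).  Let `φ : O → E` be a ring map, `q ⊆ O` and
`Q ⊆ E` primes with `φ⁻¹ Q = q`, `K ⊆ q` an ideal and `D` a derivation of `E` with `D (φ k) ∈ Q` for all `k ∈ K`.  If `f ∈ O` has `D (φ f) ∉ Q`,
then in the localisation `O' = O_q` the element `f` does NOT lie in `K O' + 𝔪_{O'}²`.  (Clear denominators: `m f = k + r`, `m ∉ q`, `k ∈ K`,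
`r ∈ q²`; apply `D ∘ φ`: `φ(m) D(φ f) + φ(f) D(φ m) ∈ Q` with `φ f ∈ Q`, `φ m ∉ Q`.) [cite: StacksProject, Tag 07PF] -/
theorem not_mem_map_sup_sq_of_derivation {O E : Type*} [CommRing O] [CommRing E] (φ : O →+* E) (q : Ideal O) [q.IsPrime]
    (Q : Ideal E) [Q.IsPrime] (hQ : Q.comap φ = q) (D : Derivation ℤ E E) (K : Ideal O) (hKq : K ≤ q) (hK : ∀ k ∈ K, D (φ k) ∈ Q)
    (f : O) (hf : D (φ f) ∉ Q) {O' : Type*} [CommRing O'] [IsLocalRing O'] [Algebra O O'] [IsLocalization.AtPrime O' q] :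
    algebraMap O O' f ∉ K.map (algebraMap O O') ⊔ maximalIdeal O' ^ 2 := by
  intro h
  have hφ : ∀ x : O, φ x ∈ Q ↔ x ∈ q := fun x => by rw [← hQ, Ideal.mem_comap]
  -- `K O' + 𝔪'² = (K + q²) O'`
  have h𝔪 : maximalIdeal O' = q.map (algebraMap O O') := (IsLocalization.AtPrime.map_eq_maximalIdeal q O').symm
  have hle : K.map (algebraMap O O') ⊔ maximalIdeal O' ^ 2 ≤ (K ⊔ q ^ 2).map (algebraMap O O') := by
    rw [h𝔪, ← Ideal.map_pow, ← Ideal.map_sup]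
  obtain ⟨m, hm, hmf⟩ := (IsLocalization.algebraMap_mem_map_algebraMap_iff q.primeCompl O' (K ⊔ q ^ 2) f).mp (hle h)
  obtain ⟨k, hk, r, hr, hkr⟩ := Submodule.mem_sup.mp hmf
  -- `f ∈ q`
  have hfq : f ∈ q := by
    have h1 : m * f ∈ q := by
      rw [← hkr]
      exact q.add_mem (hKq hk) (Ideal.pow_le_self two_ne_zero hr)
    exact ((Ideal.IsPrime.mem_or_mem ‹q.IsPrime› h1).resolve_left hm)
  -- apply `D ∘ φ`
  have hD : D (φ (m * f)) = D (φ k) + D (φ r) := by rw [← hkr, map_add, map_add]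
  rw [map_mul, Derivation.leibniz, smul_eq_mul, smul_eq_mul] at hD
  have hr' : D (φ r) ∈ Q := by
    refine derivation_apply_mem_of_mem_sq D Q ?_
    have h2 : φ r ∈ (q ^ 2).map φ := Ideal.mem_map_of_mem φ hr
    rw [Ideal.map_pow] at h2
    exact Ideal.pow_right_mono (Ideal.map_le_iff_le_comap.mpr (by rw [hQ])) 2 h2
  have h3 : φ m * D (φ f) ∈ Q := by
    have h4 : φ m * D (φ f) + φ f * D (φ m) ∈ Q := by rw [hD]; exact Q.add_mem (hK k hk) hr'
    have h5 : φ f * D (φ m) ∈ Q := Q.mul_mem_right _ ((hφ f).mpr hfq)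
    simpa using Q.sub_mem h4 h5
  rcases (Ideal.IsPrime.mem_or_mem ‹Q.IsPrime› h3) with h6 | h6
  · exact hm ((hφ m).mp h6)
  · exact hf h6

/-! ## §1 Abstract chart data of a point blowing up: sides against near lines -/

section AbstractChart

variable {R : Type u} [CommRing R] [IsRegularLocalRing R] {d : ℕ} (t : Fin d → R) (j : Fin d)
  (hspan : Ideal.span (Set.range t) = maximalIdeal R)
  {A : Type u} [CommRing A] (ψ : R →+* A) (uA : Fin d → A)
  (hrel : ∀ i, ψ (t i) = ψ (t j) * uA i) (hnzd : ψ (t j) ∈ nonZeroDivisors A)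
  (ε : MvPolynomial {i : Fin d // i ≠ j} (R ⧸ Ideal.span (Set.range t)) ≃+* A ⧸ Ideal.span {ψ (t j)})
  (hεC : ∀ r : R, ε (C (Ideal.Quotient.mk (Ideal.span (Set.range t)) r)) = Ideal.Quotient.mk _ (ψ r))
  (hεX : ∀ i : {i : Fin d // i ≠ j}, ε (X i) = Ideal.Quotient.mk _ (uA i.1))
  (𝔓 : Ideal A) [𝔓.IsPrime] (h𝔓 : 𝔓.comap ψ = maximalIdeal R)
  (L : Type u) [CommRing L] [IsLocalRing L] [Algebra A L] [IsLocalization.AtPrime L 𝔓]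

include hspan hrel in
/-- **The transform of a side**: for `t' ∈ 𝔪_R = (t)`, written `t' = Σ_k m_k t_k`, one has `ψ(t') = ψ(t_j) · Σ_k ψ(m_k) u_k`. [folklore] -/
theorem exists_side_eq_mul {t' : R} (ht' : t' ∈ maximalIdeal R) :
    ∃ m : Fin d → R, t' = ∑ k, m k * t k ∧ ψ t' = ψ (t j) * ∑ k, ψ (m k) * uA k := by
  rw [← hspan] at ht'
  obtain ⟨m, hm⟩ := Ideal.mem_span_range_iff_exists_fun.mp ht'
  refine ⟨m, hm.symm, ?_⟩
  rw [← hm, map_sum, Finset.mul_sum]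
  exact Finset.sum_congr rfl fun k _ => by rw [map_mul, hrel k]; ring

include hspan hrel hnzd hεC hεX h𝔓 in
/-- **NO TANGENCY: a clean side containing the near line to first order contains it.**  With `N = (ψ t_j, u_{j₀})` (`u_{j₀} ∈ 𝔓`, so `j₀ ≠ j`) the
near line through the point and `s = Σ_k ψ(m_k) u_k` the transform of a side: if `s ∈ N L + 𝔪_L²` then `s ∈ N` (already in `A`).
[cite: StacksProject, Tag 07PF] [cite: CossartPiltant2008, Lemma 4.3 (5)] -/
theorem side_mem_nearLine_of_mem_sup_sq (j₀ : Fin d) (hj₀𝔓 : uA j₀ ∈ 𝔓) (m : Fin d → R)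
    (h : algebraMap A L (∑ k, ψ (m k) * uA k) ∈
      (Ideal.span {ψ (t j), uA j₀}).map (algebraMap A L) ⊔ maximalIdeal L ^ 2) :
    (∑ k, ψ (m k) * uA k) ∈ (Ideal.span {ψ (t j), uA j₀} : Ideal A) := by
  classical
  have hP : 𝔓.IsPrime := ‹_›
  haveI : (Ideal.span (Set.range t)).IsMaximal := isMaximal_span_rsop t hspan
  letI : Field (R ⧸ Ideal.span (Set.range t)) := Ideal.Quotient.field _
  have huj : uA j = 1 := chartFrac_self t j ψ uA hrel hnzd
  have htj𝔓 : ψ (t j) ∈ 𝔓 := map_rsop_mem_chartPrime t hspan ψ 𝔓 h𝔓 j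
  -- `ψ(𝔪_R) ⊆ (ψ t_j)`
  have hψm : ∀ r ∈ maximalIdeal R, ψ r ∈ (Ideal.span {ψ (t j)} : Ideal A) := by
    intro r hr
    obtain ⟨m', -, h'⟩ := exists_side_eq_mul t j hspan ψ uA hrel hr
    rw [h']
    exact Ideal.mul_mem_right _ _ (Ideal.mem_span_singleton_self _)
  set K : Ideal A := Ideal.span {ψ (t j), uA j₀} with hK
  have hKle : (Ideal.span {ψ (t j)} : Ideal A) ≤ K := by
    rw [Ideal.span_singleton_le_iff_mem]; exact Ideal.subset_span (by simp)
  have hK𝔓 : K ≤ 𝔓 := by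
    rw [hK, Ideal.span_le, Set.insert_subset_iff, Set.singleton_subset_iff]; exact ⟨htj𝔓, hj₀𝔓⟩
  set φE := ε.symm.toRingHom.comp (Ideal.Quotient.mk (Ideal.span {ψ (t j)})) with hφE
  obtain ⟨Q, hQprime, hQ⟩ := exists_prime_comap_chartReduction t j hspan ψ ε 𝔓 h𝔓
  haveI := hQprime
  have hmemQ : ∀ x : A, φE x ∈ Q ↔ x ∈ 𝔓 := fun x => by rw [← hQ, Ideal.mem_comap]
  have hφEt : φE (ψ (t j)) = 0 := by
    rw [hφE, chartReduction_map t j ψ ε hεC,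
      Ideal.Quotient.eq_zero_iff_mem.mpr (Ideal.subset_span ⟨j, rfl⟩ : t j ∈ Ideal.span (Set.range t)), map_zero]
  -- Step 1: every `m_k`, `k ≠ j, j₀`, lies in `𝔪_R` (derivation `∂/∂T_k` of the exceptional chart)
  have hmk : ∀ k, k ≠ j → k ≠ j₀ → m k ∈ maximalIdeal R := by
    intro k hkj hkj₀
    by_contra hmk
    let k' : {i : Fin d // i ≠ j} := ⟨k, hkj⟩
    obtain ⟨D, hDC, hDX⟩ := MvPolynomial.exists_derivation_C_eq_X_eq (σ := {i : Fin d // i ≠ j})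
      (T := MvPolynomial {i : Fin d // i ≠ j} (R ⧸ Ideal.span (Set.range t)))
      (0 : Derivation ℤ (R ⧸ Ideal.span (Set.range t)) (MvPolynomial {i : Fin d // i ≠ j} (R ⧸ Ideal.span (Set.range t))))
      (fun i => if i = k' then 1 else 0)
    -- values of `D ∘ φE` on the fractions and on `ψ(R)`
    have hDψ : ∀ r : R, D (φE (ψ r)) = 0 := fun r => by
      rw [hφE, chartReduction_map t j ψ ε hεC, hDC]; rfl
    have hDu : ∀ i : Fin d, D (φE (uA i)) = if i = k then 1 else 0 := by
      intro i
      by_cases hij : i = j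
      · rw [hij, huj, map_one, Derivation.map_one_eq_zero, if_neg (Ne.symm hkj)]
      · rw [hφE, chartReduction_frac t j ψ uA ε hεX ⟨i, hij⟩, hDX]
        by_cases hik : i = k
        · subst hik; simp [k']
        · have hne : (⟨i, hij⟩ : {i : Fin d // i ≠ j}) ≠ k' := fun h' => hik (congrArg Subtype.val h')
          rw [if_neg hne, if_neg hik]
    -- `D (φE K) ⊆ Q`
    have hKQ : ∀ x ∈ K, D (φE x) ∈ Q := by
      intro x hx
      obtain ⟨a₁, a₂, rfl⟩ := Ideal.mem_span_pair.mp hx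
      have h1 : D (φE (a₁ * ψ (t j) + a₂ * uA j₀)) = φE (uA j₀) * D (φE a₂) := by
        rw [map_add, map_mul, map_mul, hφEt, mul_zero, zero_add, Derivation.leibniz, smul_eq_mul, smul_eq_mul, hDu j₀,
          if_neg (Ne.symm hkj₀), mul_zero, zero_add]
      rw [h1]
      exact Q.mul_mem_right _ ((hmemQ _).mpr hj₀𝔓)
    -- `D (φE s) = m̄_k`, a non-zero constant
    have hDf : D (φE (∑ i, ψ (m i) * uA i)) = C (Ideal.Quotient.mk (Ideal.span (Set.range t)) (m k)) := by
      rw [map_sum, map_sum]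
      have h1 : ∀ i, D (φE (ψ (m i) * uA i)) = if i = k then C (Ideal.Quotient.mk (Ideal.span (Set.range t)) (m i)) else 0 := by
        intro i
        rw [map_mul, Derivation.leibniz, smul_eq_mul, smul_eq_mul, hDψ, mul_zero, add_zero, hDu i, hφE,
          chartReduction_map t j ψ ε hεC]
        split_ifs <;> simp
      rw [Finset.sum_congr rfl (fun i _ => h1 i), Finset.sum_ite_eq' Finset.univ k, if_pos (Finset.mem_univ _)]
    have hmk' : Ideal.Quotient.mk (Ideal.span (Set.range t)) (m k) ≠ 0 := by
      rw [Ne, Ideal.Quotient.eq_zero_iff_mem, hspan]; exact hmk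
    have hf : D (φE (∑ i, ψ (m i) * uA i)) ∉ Q := by
      rw [hDf]
      intro hC
      exact hQprime.ne_top' (Ideal.eq_top_of_isUnit_mem Q hC ((IsUnit.mk0 _ hmk').map C))
    exact not_mem_map_sup_sq_of_derivation φE 𝔓 Q hQ D K hK𝔓 hKQ _ hf (O' := L) h
  -- Step 2: `m_j ∈ 𝔪_R` as well (`s ∈ 𝔪_L`)
  have hterm : ∀ k, k ≠ j → ψ (m k) * uA k ∈ 𝔓 := by
    intro k hkj
    by_cases hkj₀ : k = j₀
    · rw [hkj₀]; exact 𝔓.mul_mem_left _ hj₀𝔓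
    · exact 𝔓.mul_mem_right _ (hK𝔓 (hKle (hψm _ (hmk k hkj hkj₀))))
  have hs𝔓 : (∑ k, ψ (m k) * uA k) ∈ 𝔓 := by
    have h1 : algebraMap A L (∑ k, ψ (m k) * uA k) ∈ maximalIdeal L := by
      have hle' : K.map (algebraMap A L) ⊔ maximalIdeal L ^ 2 ≤ maximalIdeal L := by
        refine sup_le ?_ (Ideal.pow_le_self two_ne_zero)
        rw [← IsLocalization.AtPrime.map_eq_maximalIdeal 𝔓 L]
        exact Ideal.map_mono hK𝔓
      exact hle' h
    exact (IsLocalization.AtPrime.to_map_mem_maximal_iff L 𝔓 _).mp h1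
  have hmj : m j ∈ maximalIdeal R := by
    have h1 : ψ (m j) * uA j ∈ 𝔓 := by
      rw [← Finset.add_sum_erase Finset.univ (fun k => ψ (m k) * uA k) (Finset.mem_univ j)] at hs𝔓
      have h2 : ∑ k ∈ Finset.univ.erase j, ψ (m k) * uA k ∈ 𝔓 :=
        Ideal.sum_mem _ fun k hk => hterm k (Finset.ne_of_mem_erase hk)
      simpa using 𝔓.sub_mem hs𝔓 h2
    rw [huj, mul_one] at h1
    rwa [← h𝔓, Ideal.mem_comap]
  -- conclusion: every summand lies in `K`
  refine Ideal.sum_mem _ fun k _ => ?_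
  by_cases hkj₀ : k = j₀
  · rw [hkj₀]; exact K.mul_mem_left _ (Ideal.subset_span (by simp))
  · refine K.mul_mem_right _ (hKle (hψm _ ?_))
    by_cases hkj : k = j
    · rw [hkj]; exact hmj
    · exact hmk k hkj hkj₀

include hspan hrel hnzd hεC hεX h𝔓 in
/-- **A clean side through the point is transversal to the near line or contains it** (no tangency): with a third parameter `z'`
(`(ψ t_j, u_{j₀}, z') = 𝔪_L`) and `s = Σ_k ψ(m_k) u_k ∈ 𝔪_L` the transform of a side through the point, either `(ψ t_j, u_{j₀}, s) = 𝔪_L` or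
`s ∈ (ψ t_j, u_{j₀})`. [cite: CossartPiltant2008, Lemma 4.3 (5)] [cite: Piltant2013, §2 Axiom 4] -/
theorem side_trichotomy_nearLine (j₀ : Fin d) (hj₀𝔓 : uA j₀ ∈ 𝔓) (m : Fin d → R) {z' : L}
    (hzz : Ideal.span ({algebraMap A L (ψ (t j)), algebraMap A L (uA j₀), z'} : Set L) = maximalIdeal L)
    (hs : algebraMap A L (∑ k, ψ (m k) * uA k) ∈ maximalIdeal L) :
    Ideal.span ({algebraMap A L (ψ (t j)), algebraMap A L (uA j₀), algebraMap A L (∑ k, ψ (m k) * uA k)} : Set L) = maximalIdeal L ∨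
      (∑ k, ψ (m k) * uA k) ∈ (Ideal.span {ψ (t j), uA j₀} : Ideal A) := by
  have he'm : algebraMap A L (ψ (t j)) ∈ maximalIdeal L := hzz ▸ Ideal.subset_span (by simp)
  have hym : algebraMap A L (uA j₀) ∈ maximalIdeal L := hzz ▸ Ideal.subset_span (by simp)
  have hz'm : z' ∈ maximalIdeal L := hzz ▸ Ideal.subset_span (by simp)
  -- write `s = α e + β y' + γ z'`
  have hs' := hs
  rw [← hzz, Ideal.mem_span_insert] at hs'
  obtain ⟨α, y, hy, hsy⟩ := hs'
  rw [Ideal.mem_span_insert] at hy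
  obtain ⟨β, y'', hy'', hyy⟩ := hy
  obtain ⟨γ, rfl⟩ := Ideal.mem_span_singleton'.mp hy''
  by_cases hγ : IsUnit γ
  · left
    obtain ⟨g, rfl⟩ := hγ
    have hz' : z' = ↑g⁻¹ * (algebraMap A L (∑ k, ψ (m k) * uA k) - α * algebraMap A L (ψ (t j)) - β * algebraMap A L (uA j₀)) := by
      rw [hsy, hyy]
      have h1 : α * algebraMap A L (ψ (t j)) + (β * algebraMap A L (uA j₀) + ↑g * z') - α * algebraMap A L (ψ (t j)) -
          β * algebraMap A L (uA j₀) = ↑g * z' := by ring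
      rw [h1, ← mul_assoc, Units.inv_mul, one_mul]
    apply le_antisymm
    · rw [Ideal.span_le, Set.insert_subset_iff, Set.insert_subset_iff, Set.singleton_subset_iff]
      exact ⟨he'm, hym, hs⟩
    · rw [← hzz, Ideal.span_le, Set.insert_subset_iff, Set.insert_subset_iff, Set.singleton_subset_iff]
      refine ⟨Ideal.subset_span (by simp), Ideal.subset_span (by simp), ?_⟩
      rw [SetLike.mem_coe, hz']
      exact Ideal.mul_mem_left _ _ (Ideal.sub_mem _ (Ideal.sub_mem _ (Ideal.subset_span (by simp))
        (Ideal.mul_mem_left _ _ (Ideal.subset_span (by simp)))) (Ideal.mul_mem_left _ _ (Ideal.subset_span (by simp))))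
  · right
    refine side_mem_nearLine_of_mem_sup_sq t j hspan ψ uA hrel hnzd ε hεC hεX 𝔓 h𝔓 L j₀ hj₀𝔓 m ?_
    rw [hsy, hyy, ← add_assoc, Ideal.map_span, Set.image_pair]
    refine Ideal.add_mem _ (Ideal.mem_sup_left (Ideal.add_mem _ (Ideal.mul_mem_left _ _ (Ideal.subset_span (by simp)))
      (Ideal.mul_mem_left _ _ (Ideal.subset_span (by simp))))) (Ideal.mem_sup_right ?_)
    rw [pow_two]
    exact Ideal.mul_mem_mul ((mem_maximalIdeal _).mpr hγ) hz'm

end AbstractChart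

end Summit.ResolutionOfSingularities.ResolutionOfSingularities.Theorems.RadicialJung.CleanModels

end
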